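import Summits.QuantumFields.BalabanUV.Beta.GAN24.DirichletRingPath

/-!
# `BalabanUV.Beta.GAN24.DirichletRingFlux` — binder row G-an2-4 / (CONV-C), road P2 PART IV, leaf L5 of the ring lemma: THE FLUX BOUND AT A
# RE-ENTRANT BLOCK VERTEX and the recursion line fed to L7 (unit b2b-balaban-gan24-formalise-leaf-06, gen 30, v1; part 2 of 2 — part 1
# `DirichletRingPath` = leaf L3, the objects `Ering/Rring/Tring/outNorm/flux/cRing/pathVal`)

HONEST FRAMING (cell contract, verbatim): «discharging `BetaPertH` makes Bałaban's UV stability UNCONDITIONAL — a real constructive-QFT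
result; it is NOT the continuum limit and NOT the Clay problem.»  Pure finite-sum brick for the ring lemma of the road-P2 owner's memo
`HOME/b2b-balaban-gan24-p2/gen24/W-FULL-WEIGHTED.md` §3, leaf L5 «flux bound» (`|Φ_k| ≤ (c_k/2)·ΔẼ_k`), in the chart coordinates of part 1
(`Q_k = [−k,k)² ⊂ ℤ × ℤ`, `U : ℤ → ℤ → ℂ` vanishing on the quadrant `{0 ≤ s} × {0 ≤ t}` — hypothesis `hU` displayed):
 * `corners_le` — the three corner values by L6's telescope `DirichletRingPoincare.norm_sq_le_mul_sum_tele` along the path to its zero end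
   (total weight `9k − 3`, the memo's `3·(3k−1)`);
 * **`outNorm_le`** — `Σ_{outward bonds} ‖U(x_b)‖² ≤ cRing k · Tring k U` (L1–L2 `DirichletRingWirtinger.wirtinger_path_explicit` on the `6k−2`-edge
   ring path of part 1 + the corners), `cRing k = (6k−2)²/π² + 1/6 + (9k − 3)`;
 * **`norm_flux_le`** (L5) — `‖flux k U‖ ≤ (√(cRing k)/2)·(Tring k U + Rring k U)` (termwise weighted AM–GM with weight `1/√(cRing k)`;
   `norm_flux_le_weighted` is the form with a free weight);
 * `recursion_step` / **`ring_recursion`** — if `Ering k U ≤ A + ‖flux k U‖` (what L4's Green identity on `Q_k(c)` and the source pairing give,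
   `A = |Σ_{S_k} Ū F|`), then `Ẽ_{k−1} ≤ (1 − θ_k)·Ẽ_k + θ_k·A`, `Ẽ_j = Ering j U + Rring j U`, `θ_k = 1/(√(cRing k)/2 + 1)` — the input line of
   L7 `DirichletRingGronwall.decay_of_recursion` (whose hypothesis `γ/(k+A) ≤ θ_k`, `γ = π/3·(1−ε/2) > 1`, is the L8 assembler's arithmetic on `cRing`).

ABSOLUTE RULE (cell, verbatim): «No internally-minted statement may enter as a cited fact. Every hypothesis is either kernel-proved in
this package or a verbatim quotation of a PUBLISHED theorem with page reference. The manuscript(s) under audit are NOT citable for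
their own disputed steps — they are the thing under adjudication; programme-internal (2001/route/tribunal) claims are never citable.»
[folklore] finite sums; nothing printed is a hypothesis; 0 `def`.  NOT CLAIMED: L8 (the energy decay `D₂`), (A)/(B), the weighted END, NE2, (CONV-C),
`BetaPertH`, continuum, Clay.  «not in print; our proof attempt».  HONEST DEPENDENCY: continuum YM on T⁴ ⇐ BetaPertH ∧ nine spine estimates
(0/9 proved); BetaPertH ⇐ (D1) ∧ (D4) ∧ CAP+tail; G-an2-4 gates asym, D1 and NE2/3/4.
-/

noncomputable section

open scoped BigOperators ComplexConjugate
open Finset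

namespace Summit.QuantumFields.BalabanUV.Beta.GAN24.DirichletRingFlux

open Summit.QuantumFields.BalabanUV.Beta.GAN24.DirichletRingWirtinger (wirtinger_path_explicit)
open Summit.QuantumFields.BalabanUV.Beta.GAN24.DirichletRingPoincare (norm_sq_le_mul_sum_tele)
open Summit.QuantumFields.BalabanUV.Beta.GAN24.DirichletRingPath

/-! ## §1 Corners and the Wirtinger step: `outNorm ≤ c_k²·T_k` -/

/-- **the corner values by the telescope** (L6's `norm_sq_le_mul_sum_tele` along the path to the zero end `g(6k−2) = 0`):
`‖g k‖² + ‖g(3k−1)‖² + ‖g(5k−2)‖² ≤ (9k − 3)·Σ_{i<6k−2}‖g(i+1) − g i‖²`. [folklore] -/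
theorem corners_le {k : ℕ} (hk : 1 ≤ k) {U : ℤ → ℤ → ℂ} (hU : ∀ s t : ℤ, 0 ≤ s → 0 ≤ t → U s t = 0) :
    ‖pathVal k U k‖ ^ 2 + ‖pathVal k U (3 * k - 1)‖ ^ 2 + ‖pathVal k U (5 * k - 2)‖ ^ 2
      ≤ (9 * (k : ℝ) - 3) * ∑ i ∈ range (6 * k - 2), ‖pathVal k U (i + 1) - pathVal k U i‖ ^ 2 := by
  set P := ∑ i ∈ range (6 * k - 2), ‖pathVal k U (i + 1) - pathVal k U i‖ ^ 2 with hP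
  have hP0 : 0 ≤ P := Finset.sum_nonneg fun _ _ => sq_nonneg _
  have hlast := pathVal_last hk hU
  have c1 := norm_sq_le_mul_sum_tele (pathVal k U) (s := k) (k := 6 * k - 2) (K := 6 * k - 2) (by omega) le_rfl hlast
  have c2 := norm_sq_le_mul_sum_tele (pathVal k U) (s := 3 * k - 1) (k := 6 * k - 2) (K := 6 * k - 2) (by omega) le_rfl hlast
  have c3 := norm_sq_le_mul_sum_tele (pathVal k U) (s := 5 * k - 2) (k := 6 * k - 2) (K := 6 * k - 2) (by omega) le_rfl hlast
  have e1 : ((6 * k - 2 - k : ℕ) : ℝ) = 5 * k - 2 := by rw [Nat.cast_sub (by omega), Nat.cast_sub (by omega)]; push_cast; ring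
  have e2 : ((6 * k - 2 - (3 * k - 1) : ℕ) : ℝ) = 3 * k - 1 := by
    rw [show 6 * k - 2 - (3 * k - 1) = 3 * k - 1 by omega, Nat.cast_sub (by omega)]; push_cast; ring
  have e3 : ((6 * k - 2 - (5 * k - 2) : ℕ) : ℝ) = k := by
    rw [show 6 * k - 2 - (5 * k - 2) = k by omega]
  rw [e1] at c1; rw [e2] at c2; rw [e3] at c3
  nlinarith

/-- **`Σ_{outward bonds} ‖U(x_b)‖² ≤ c_k²·T_k`**: Wirtinger along the ring path (L1–L2 `wirtinger_path_explicit`, `6k − 2` edges, zero ends)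
for the ring sites, the telescope for the three extra corner values. [folklore] -/
theorem outNorm_le {k : ℕ} (hk : 1 ≤ k) {U : ℤ → ℤ → ℂ} (hU : ∀ s t : ℤ, 0 ≤ s → 0 ≤ t → U s t = 0) : outNorm k U ≤ cRing k * Tring k U := by
  set P := ∑ i ∈ range (6 * k - 2), ‖pathVal k U (i + 1) - pathVal k U i‖ ^ 2 with hP
  have hP0 : 0 ≤ P := Finset.sum_nonneg fun _ _ => sq_nonneg _
  have hPT : P ≤ Tring k U := pathEnergy_le_Tring hk U
  have hW := wirtinger_path_explicit (m := 6 * k - 2) (by omega) (pathVal k U) (pathVal_zero hk hU) (pathVal_last hk hU)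
  have hm : ((6 * k - 2 : ℕ) : ℝ) = 6 * k - 2 := by rw [Nat.cast_sub (by omega)]; push_cast; ring
  rw [hm] at hW
  have hC := corners_le hk hU
  rw [outNorm_eq_pathNorm_add_corners hk hU]
  have hkR : (1 : ℝ) ≤ k := by exact_mod_cast hk
  have hc1 : 0 ≤ (6 * (k : ℝ) - 2) ^ 2 / Real.pi ^ 2 + 1 / 6 := by positivity
  have hc2 : 0 ≤ 9 * (k : ℝ) - 3 := by linarith
  calc (∑ i ∈ range (6 * k - 2), ‖pathVal k U i‖ ^ 2)
        + (‖pathVal k U k‖ ^ 2 + ‖pathVal k U (3 * k - 1)‖ ^ 2 + ‖pathVal k U (5 * k - 2)‖ ^ 2)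
      ≤ ((6 * (k : ℝ) - 2) ^ 2 / Real.pi ^ 2 + 1 / 6) * P + (9 * (k : ℝ) - 3) * P := add_le_add hW hC
    _ = cRing k * P := by unfold cRing; ring
    _ ≤ cRing k * Tring k U := mul_le_mul_of_nonneg_left hPT (cRing_pos hk).le

/-! ## §2 (L5) The flux bound -/

/-- weighted AM–GM for one flux term: `‖ā·d‖ ≤ (l‖a‖² + ‖d‖²/l)/2` for `l > 0`. [folklore] -/
theorem norm_conj_mul_le (a d : ℂ) {l : ℝ} (hl : 0 < l) : ‖conj a * d‖ ≤ (l * ‖a‖ ^ 2 + ‖d‖ ^ 2 / l) / 2 := by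
  rw [Complex.norm_mul, Complex.norm_conj]
  have h := two_mul_le_add_sq (l * ‖a‖) ‖d‖
  rw [le_div_iff₀ (by norm_num : (0:ℝ) < 2)]
  have : l * ‖a‖ ^ 2 + ‖d‖ ^ 2 / l = ((l * ‖a‖) ^ 2 + ‖d‖ ^ 2) / l := by field_simp
  rw [this, le_div_iff₀ hl]
  nlinarith [norm_nonneg a, norm_nonneg d]

/-- termwise: `‖flux k U‖ ≤ (l·outNorm k U + Rring k U / l)/2` for every `l > 0`. [folklore] -/
theorem norm_flux_le_weighted (k : ℕ) (U : ℤ → ℤ → ℂ) {l : ℝ} (hl : 0 < l) :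
    ‖flux k U‖ ≤ (l * outNorm k U + Rring k U / l) / 2 := by
  have key : ∀ j : ℕ,
      ‖conj (U ((k : ℤ) - 1) ((j : ℤ) - k)) * (U ((k : ℤ) - 1) ((j : ℤ) - k) - U k ((j : ℤ) - k))
        + conj (U (-(k : ℤ)) ((j : ℤ) - k)) * (U (-(k : ℤ)) ((j : ℤ) - k) - U (-(k : ℤ) - 1) ((j : ℤ) - k))
        + conj (U ((j : ℤ) - k) ((k : ℤ) - 1)) * (U ((j : ℤ) - k) ((k : ℤ) - 1) - U ((j : ℤ) - k) k)
        + conj (U ((j : ℤ) - k) (-(k : ℤ))) * (U ((j : ℤ) - k) (-(k : ℤ)) - U ((j : ℤ) - k) (-(k : ℤ) - 1))‖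
      ≤ (l * (‖U ((k : ℤ) - 1) ((j : ℤ) - k)‖ ^ 2 + ‖U (-(k : ℤ)) ((j : ℤ) - k)‖ ^ 2
            + ‖U ((j : ℤ) - k) ((k : ℤ) - 1)‖ ^ 2 + ‖U ((j : ℤ) - k) (-(k : ℤ))‖ ^ 2)
          + (hb U ((k : ℤ) - 1) ((j : ℤ) - k) + hb U (-(k : ℤ) - 1) ((j : ℤ) - k)
            + vb U ((j : ℤ) - k) ((k : ℤ) - 1) + vb U ((j : ℤ) - k) (-(k : ℤ) - 1)) / l) / 2 := by
    intro j
    -- four-term triangle inequality (kept local: the tree's `BoseGas.Fock.norm_add₄_le` lives in an unrelated Literature module)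
    have n4 : ∀ a b c d : ℂ, ‖a + b + c + d‖ ≤ ‖a‖ + ‖b‖ + ‖c‖ + ‖d‖ := fun a b c d => by
      have h1 := norm_add_le (a + b + c) d
      have h2 := norm_add_le (a + b) c
      have h3 := norm_add_le a b
      linarith
    refine (n4 _ _ _ _).trans ?_
    have t1 := norm_conj_mul_le (U ((k : ℤ) - 1) ((j : ℤ) - k)) (U ((k : ℤ) - 1) ((j : ℤ) - k) - U k ((j : ℤ) - k)) hl
    have t2 := norm_conj_mul_le (U (-(k : ℤ)) ((j : ℤ) - k)) (U (-(k : ℤ)) ((j : ℤ) - k) - U (-(k : ℤ) - 1) ((j : ℤ) - k)) hl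
    have t3 := norm_conj_mul_le (U ((j : ℤ) - k) ((k : ℤ) - 1)) (U ((j : ℤ) - k) ((k : ℤ) - 1) - U ((j : ℤ) - k) k) hl
    have t4 := norm_conj_mul_le (U ((j : ℤ) - k) (-(k : ℤ))) (U ((j : ℤ) - k) (-(k : ℤ)) - U ((j : ℤ) - k) (-(k : ℤ) - 1)) hl
    have e1 : ‖U ((k : ℤ) - 1) ((j : ℤ) - k) - U k ((j : ℤ) - k)‖ ^ 2 = hb U ((k : ℤ) - 1) ((j : ℤ) - k) := by
      rw [hb, norm_sub_rev, sub_add_cancel]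
    have e2 : ‖U (-(k : ℤ)) ((j : ℤ) - k) - U (-(k : ℤ) - 1) ((j : ℤ) - k)‖ ^ 2 = hb U (-(k : ℤ) - 1) ((j : ℤ) - k) := by
      rw [hb, sub_add_cancel]
    have e3 : ‖U ((j : ℤ) - k) ((k : ℤ) - 1) - U ((j : ℤ) - k) k‖ ^ 2 = vb U ((j : ℤ) - k) ((k : ℤ) - 1) := by
      rw [vb, norm_sub_rev, sub_add_cancel]
    have e4 : ‖U ((j : ℤ) - k) (-(k : ℤ)) - U ((j : ℤ) - k) (-(k : ℤ) - 1)‖ ^ 2 = vb U ((j : ℤ) - k) (-(k : ℤ) - 1) := by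
      rw [vb, sub_add_cancel]
    rw [e1] at t1; rw [e2] at t2; rw [e3] at t3; rw [e4] at t4
    have hsplit : (l * (‖U ((k : ℤ) - 1) ((j : ℤ) - k)‖ ^ 2 + ‖U (-(k : ℤ)) ((j : ℤ) - k)‖ ^ 2
            + ‖U ((j : ℤ) - k) ((k : ℤ) - 1)‖ ^ 2 + ‖U ((j : ℤ) - k) (-(k : ℤ))‖ ^ 2)
          + (hb U ((k : ℤ) - 1) ((j : ℤ) - k) + hb U (-(k : ℤ) - 1) ((j : ℤ) - k)
            + vb U ((j : ℤ) - k) ((k : ℤ) - 1) + vb U ((j : ℤ) - k) (-(k : ℤ) - 1)) / l) / 2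
        = (l * ‖U ((k : ℤ) - 1) ((j : ℤ) - k)‖ ^ 2 + hb U ((k : ℤ) - 1) ((j : ℤ) - k) / l) / 2
          + (l * ‖U (-(k : ℤ)) ((j : ℤ) - k)‖ ^ 2 + hb U (-(k : ℤ) - 1) ((j : ℤ) - k) / l) / 2
          + (l * ‖U ((j : ℤ) - k) ((k : ℤ) - 1)‖ ^ 2 + vb U ((j : ℤ) - k) ((k : ℤ) - 1) / l) / 2
          + (l * ‖U ((j : ℤ) - k) (-(k : ℤ))‖ ^ 2 + vb U ((j : ℤ) - k) (-(k : ℤ) - 1) / l) / 2 := by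
      field_simp
      ring
    rw [hsplit]
    linarith
  unfold flux
  refine (norm_sum_le _ _).trans ((Finset.sum_le_sum fun j _ => key j).trans (le_of_eq ?_))
  simp only [outNorm, Rring, div_eq_mul_inv, Finset.mul_sum, Finset.sum_mul, ← Finset.sum_add_distrib]

/-- **(L5) THE FLUX BOUND**: for `k ≥ 1` and `U` vanishing on the quadrant,
`‖flux k U‖ ≤ (√(cRing k)/2)·(Tring k U + Rring k U)`. [folklore] -/
theorem norm_flux_le {k : ℕ} (hk : 1 ≤ k) {U : ℤ → ℤ → ℂ} (hU : ∀ s t : ℤ, 0 ≤ s → 0 ≤ t → U s t = 0) :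
    ‖flux k U‖ ≤ Real.sqrt (cRing k) / 2 * (Tring k U + Rring k U) := by
  have hc := cRing_pos hk
  set c := Real.sqrt (cRing k) with hcdef
  have hc' : 0 < c := Real.sqrt_pos.mpr hc
  have hcc : c * c = cRing k := Real.mul_self_sqrt hc.le
  have h := norm_flux_le_weighted k U (l := 1 / c) (by positivity)
  have hO := outNorm_le hk hU
  have hT := Tring_nonneg k U
  calc ‖flux k U‖ ≤ (1 / c * outNorm k U + Rring k U / (1 / c)) / 2 := h
    _ ≤ (1 / c * (cRing k * Tring k U) + Rring k U / (1 / c)) / 2 := by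
        gcongr
    _ = c / 2 * (Tring k U + Rring k U) := by
        rw [← hcc]; field_simp

/-! ## §3 The recursion line consumed by L7 -/

/-- **the algebra of one ring step**: if `Ẽ − Ẽ' = T + R` (L3a), `Ẽ − R ≤ A + (c/2)(T + R)` (`E_k ≤ A_k + |Φ_k|` with L5), `T, c ≥ 0`,
then `Ẽ' ≤ (1 − θ)·Ẽ + θ·A` with `θ = 1/(c/2 + 1)` (`R ≥ 0` is not even needed). [folklore] -/
theorem recursion_step {E' Et T R A c : ℝ} (hT : 0 ≤ T) (hc : 0 ≤ c) (hΔ : Et - E' = T + R)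
    (hE : Et - R ≤ A + c / 2 * (T + R)) :
    E' ≤ (1 - 1 / (c / 2 + 1)) * Et + 1 / (c / 2 + 1) * A := by
  have hpos : 0 < c / 2 + 1 := by linarith
  have h1 : Et ≤ A + (c / 2 + 1) * (Et - E') := by nlinarith
  rw [show (1 - 1 / (c / 2 + 1)) * Et + 1 / (c / 2 + 1) * A = Et - (Et - A) / (c / 2 + 1) by field_simp; ring]
  rw [le_sub_iff_add_le, ← le_sub_iff_add_le', div_le_iff₀ hpos]
  nlinarith

/-- **THE RECURSION LINE OF THE RING LEMMA** (input of L7 `DirichletRingGronwall.decay_of_recursion`): for `k ≥ 1`, `U` vanishing on the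
quadrant, and any `A` with `E_k ≤ A + |Φ_k|` (what the Green identity L4 on `Q_k(c)` and the source pairing give, `A = |Σ_{S_k} Ū F|`),
`Ẽ_{k−1} ≤ (1 − θ_k)·Ẽ_k + θ_k·A` with `Ẽ_j := Ering j U + Rring j U` and `θ_k = 1/(√(cRing k)/2 + 1)`. [folklore] -/
theorem ring_recursion {k : ℕ} (hk : 1 ≤ k) {U : ℤ → ℤ → ℂ} (hU : ∀ s t : ℤ, 0 ≤ s → 0 ≤ t → U s t = 0) {A : ℝ} (hA : Ering k U ≤ A + ‖flux k U‖) :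
    Ering (k - 1) U + Rring (k - 1) U
      ≤ (1 - 1 / (Real.sqrt (cRing k) / 2 + 1)) * (Ering k U + Rring k U) + 1 / (Real.sqrt (cRing k) / 2 + 1) * A := by
  obtain ⟨k', rfl⟩ : ∃ k', k = k' + 1 := ⟨k - 1, by omega⟩
  rw [Nat.add_sub_cancel]
  have hsucc := Ering_succ k' U
  have hflux := norm_flux_le hk hU
  exact recursion_step (R := Rring (k' + 1) U) (Tring_nonneg (k' + 1) U) (Real.sqrt_nonneg _) (by rw [hsucc]; ring)
    (by linarith)

end Summit.QuantumFields.BalabanUV.Beta.GAN24.DirichletRingFlux
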